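import Summits.NavierStokesRegularity.NavierStokesRegularity.Theorems.SoloRefuteAlneel2026Disp6Fields
import HarnessLib

/-!
# Solo refutation kit — C156 `Alneel2026`, display (6), part 2: `Step6_display C` is false for every `C`

D-0090 NS-CLAIMS, refuter kit (ns-claims-refuter-4 g6), filed through a salvage seat (conv. (b)).

M. O. Alneel, *An Elementary Proof of the Clay Navier–Stokes Regularity Conjecture*
(arXiv:2604.06974v3, 14 Apr 2026). Step 6 (display (6), p.2 l.43–49) asserts, along every smooth
solution and at every *energy-concentration centre* `x₀` (a point whose ball of the minimal radius
`R_inf(t)` holds half the energy), the bound `R_inf(t)² · X_loc(t) ≤ 8 C E₀` with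
`X_loc = ∫_{B(x₀, 2R_inf)} |∇u|²`. The skeleton types it as
`Literature.Claims.NS.Alneel2026.Step6_display C` (`AlongSolutions …`); its `t = 0` face on
admissible data is `Step6_field C` (`step6_field_of`, skeleton l.526).

**Refutation (every `C`).** With the four-translate datum `W_N` of part 1
(`SoloRefuteAlneel2026Disp6Fields`) and `m_N = ∫‖w_N‖²`: `∫‖W_N‖² = 4 m_N`, so `E₀ = 2 m_N` and
`E₀/2 = m_N`; every ball of radius `r < 2` captures `< m_N` (it meets at most one translate, and
strictly sub-captures it), while `B(0,2)` captures exactly `m_N` — hence **`R_inf(E₀, W_N) = 2`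
exactly** (`Rinf_eq_two`) and `0` is a centre (`isCentre_zero`). Display (6) at `x₀ = 0` then reads
`4 · X(B(0,4)) ≤ 8 C E₀ = 16 C m_N`; but `X(B(0,4)) ≥ N² |B(0,1)|` (`|∇w_N|²_F ≥ N²` on `B(0,1)`,
landed `frob_w_ge`) while `m_N ≤ (1 + ‖curlCLM‖K)² |B̄(0,2)|` uniformly in `N ≥ 1` — false for
`N := 4|C|(1 + ‖curlCLM‖K)²|B̄₂|/|B₁| + 1` (`not_disp6`). Main results: `not_Step6_field`,
`not_Step6_display` (binder (6) of `thm21_of_steps`, consumed ahead of the adjudicated head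
`Step_P3tail`), `not_exists_Step6_display`.

WHAT THIS IS NOT: not a claim about NS regularity or blow-up; not a claim about any author
beyond the typed locator. [cite: Alneel2026, display (6) p.2 l.43–49; Thm 2.1 p.1 l.24–28]
-/

open Real Set Function MeasureTheory Metric
open scoped ENNReal NNReal ContDiff Topology

set_option linter.dupNamespace false

namespace Summit.NavierStokesRegularity.NavierStokesRegularity.Theorems.Alneel2026Disp6

open Literature.Analysis Literature.Analysis.FluidPDE
open Literature.Claims.NS.Alneel2026
open Literature.Claims.NS.Chae2007 (IsDatum)
open Summit.NavierStokesRegularity.NavierStokesRegularity.Theorems.Alneel2026Second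

/-! ## 4. Energy bookkeeping: `∫‖W_N‖² = 4 m_N`, `E₀ = 2 m_N` -/

/-- `∫ ‖W_N‖² = 4 ∫ ‖w_N‖²`. [folklore] -/
theorem lintegral_W (N : ℝ) : ∫⁻ x, ‖W N x‖ₑ ^ 2 = 4 * ∫⁻ y, ‖w N y‖ₑ ^ 2 := by
  simp_rw [enormsq_W]
  have hmeas : ∀ k : Fin 4, Measurable fun x : E3 => ‖w N (x - c k)‖ₑ ^ 2 := fun k =>
    (measurable_enormsq_w N).comp (measurable_id.sub_const (c k))
  rw [lintegral_finsetSum Finset.univ fun k _ => hmeas k]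
  have : ∀ k : Fin 4, ∫⁻ x, ‖w N (x - c k)‖ₑ ^ 2 = ∫⁻ y, ‖w N y‖ₑ ^ 2 := fun k =>
    lintegral_sub_right_eq_self (fun y => ‖w N y‖ₑ ^ 2) (c k)
  simp_rw [this]
  rw [Finset.sum_const, Finset.card_univ, Fintype.card_fin, nsmul_eq_mul]
  norm_num

/-- `E₀(W_N) = 2 m_N`. [folklore] -/
theorem energyF_W (N : ℝ) : energyF (W N) = 2 * (∫⁻ y, ‖w N y‖ₑ ^ 2).toReal := by
  rw [energyF, lintegral_W, ENNReal.toReal_mul]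
  norm_num
  ring

/-- `E₀(W_N)/2 = m_N` in `ℝ≥0∞` (for `N ≥ 1`, where `m_N < ∞`). [folklore] -/
theorem half_energy_eq {K : ℝ} (hK : ∀ x, ‖fderiv ℝ φ x‖ ≤ K) {N : ℝ} (hN : 1 ≤ N) :
    ENNReal.ofReal (energyF (W N) / 2) = ∫⁻ y, ‖w N y‖ₑ ^ 2 := by
  rw [energyF_W, mul_div_cancel_left₀ _ (two_ne_zero' ℝ)]
  exact ENNReal.ofReal_toReal (lintegral_w_lt_top hK hN).ne

/-! ## 5. `R_inf = 2` exactly, and `0` is a centre -/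

/-- Translating a ball integral of a translate. [folklore] -/
theorem setLIntegral_ball_sub (f : E3 → ℝ≥0∞) (x₀ a : E3) (r : ℝ) :
    ∫⁻ y in ball x₀ r, f (y - a) = ∫⁻ y in ball (x₀ - a) r, f y := by
  rw [← lintegral_indicator measurableSet_ball, ← lintegral_indicator measurableSet_ball]
  have h : ∀ y, (ball x₀ r).indicator (fun y => f (y - a)) y =
      (ball (x₀ - a) r).indicator f (y - a) := by
    intro y
    by_cases hy : y ∈ ball x₀ r
    · have hy' : y - a ∈ ball (x₀ - a) r := by
        rw [mem_ball, dist_eq_norm] at hy ⊢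
        simpa using hy
      rw [indicator_of_mem hy, indicator_of_mem hy']
    · have hy' : y - a ∉ ball (x₀ - a) r := by
        rw [mem_ball, dist_eq_norm] at hy ⊢
        simpa using hy
      rw [indicator_of_notMem hy, indicator_of_notMem hy']
  simp_rw [h]
  exact lintegral_sub_right_eq_self (fun y => (ball (x₀ - a) r).indicator f y) a

/-- **No ball of radius `r < 2` captures half the energy.** [folklore] -/
theorem locEnergy_lt {K : ℝ} (hK : ∀ x, ‖fderiv ℝ φ x‖ ≤ K) {N : ℝ} (hN : 1 ≤ N)
    {r : ℝ} (hr0 : 0 < r) (hr : r < 2) (x₀ : E3) :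
    locEnergy (W N) x₀ r < ∫⁻ y, ‖w N y‖ₑ ^ 2 := by
  have hN0 : N ≠ 0 := by positivity
  unfold locEnergy
  by_cases h : ∃ k : Fin 4, ‖x₀ - c k‖ < 4
  · obtain ⟨k, hk⟩ := h
    -- on the ball only the `k`-th translate is alive
    have heq : ∀ y ∈ ball x₀ r, ‖W N y‖ₑ ^ 2 = ‖w N (y - c k)‖ₑ ^ 2 := by
      intro y hy
      rw [W_apply, Finset.sum_eq_single k (fun j _ hj => w_sub_eq_zero ?_)
        (fun h => (h (Finset.mem_univ _)).elim)]
      rw [mem_ball, dist_eq_norm] at hy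
      have h1 := twenty_le_norm_c_sub hj
      have h2 : ‖c j - c k‖ ≤ ‖y - c j‖ + ‖y - x₀‖ + ‖x₀ - c k‖ := by
        have : c j - c k = (y - x₀) + (x₀ - c k) - (y - c j) := by abel
        rw [this]
        refine (norm_sub_le _ _).trans ?_
        have := norm_add_le (y - x₀) (x₀ - c k)
        linarith
      linarith
    rw [setLIntegral_congr_fun measurableSet_ball heq,
      setLIntegral_ball_sub (fun y => ‖w N y‖ₑ ^ 2) x₀ (c k) r]
    exact setLIntegral_ball_lt hK hN hr0 hr _
  · push Not at h
    have heq : ∀ y ∈ ball x₀ r, ‖W N y‖ₑ ^ 2 = 0 := by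
      intro y hy
      rw [W_apply, Finset.sum_eq_zero fun j _ => w_sub_eq_zero ?_]
      · simp
      rw [mem_ball, dist_eq_norm] at hy
      have h1 := h j
      have h2 : ‖x₀ - c j‖ ≤ ‖y - x₀‖ + ‖y - c j‖ := by
        have : x₀ - c j = (y - c j) - (y - x₀) := by abel
        rw [this]
        exact (norm_sub_le _ _).trans (by rw [add_comm])
      linarith
    rw [setLIntegral_congr_fun measurableSet_ball heq, lintegral_zero]
    exact lt_of_lt_of_le (measure_ball_pos volume (0 : E3) one_pos)
      (volume_ball_le_lintegral_w hN0)

/-- `B(0,2)` captures exactly `m_N`. [folklore] -/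
theorem locEnergy_zero_two (N : ℝ) : locEnergy (W N) 0 2 = ∫⁻ y, ‖w N y‖ₑ ^ 2 := by
  unfold locEnergy
  have heq : ∀ y ∈ ball (0 : E3) 2, ‖W N y‖ₑ ^ 2 = ‖w N y‖ₑ ^ 2 := fun y hy => by
    rw [W_eq_w (ball_subset_ball (by norm_num) hy)]
  rw [setLIntegral_congr_fun measurableSet_ball heq]
  refine setLIntegral_eq_of_support_subset fun y hy => ?_
  have hy' : w N y ≠ 0 := by
    intro h; apply hy; simp [h]
  exact support_w_subset N (mem_support.mpr hy')

/-- `2 ∈ capRadii`. [folklore] -/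
theorem two_mem_capRadii {K : ℝ} (hK : ∀ x, ‖fderiv ℝ φ x‖ ≤ K) {N : ℝ} (hN : 1 ≤ N) :
    (2 : ℝ) ∈ capRadii (energyF (W N)) (W N) :=
  ⟨two_pos, 0, by rw [half_energy_eq hK hN, locEnergy_zero_two]⟩

/-- Every capturing radius is `≥ 2`. [folklore] -/
theorem two_le_of_mem_capRadii {K : ℝ} (hK : ∀ x, ‖fderiv ℝ φ x‖ ≤ K) {N : ℝ} (hN : 1 ≤ N)
    {r : ℝ} (hr : r ∈ capRadii (energyF (W N)) (W N)) : 2 ≤ r := by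
  obtain ⟨hr0, x₀, hx₀⟩ := hr
  by_contra h
  push Not at h
  rw [half_energy_eq hK hN] at hx₀
  exact absurd hx₀ (not_le.mpr (locEnergy_lt hK hN hr0 h x₀))

/-- **`R_inf(E₀, W_N) = 2` exactly.** [folklore] -/
theorem Rinf_eq_two {K : ℝ} (hK : ∀ x, ‖fderiv ℝ φ x‖ ≤ K) {N : ℝ} (hN : 1 ≤ N) :
    Rinf (energyF (W N)) (W N) = 2 := by
  unfold Rinf
  refine le_antisymm ?_ (le_sInf ?_)
  · have h := sInf_le (Set.mem_image_of_mem ENNReal.ofReal (two_mem_capRadii hK hN))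
    simpa using h
  · rintro z ⟨r, hr, rfl⟩
    have h := two_le_of_mem_capRadii hK hN hr
    calc (2 : ℝ≥0∞) = ENNReal.ofReal 2 := by simp
      _ ≤ ENNReal.ofReal r := ENNReal.ofReal_le_ofReal h

/-- **`0` is an energy-concentration centre of `W_N`.** [folklore] -/
theorem isCentre_zero {K : ℝ} (hK : ∀ x, ‖fderiv ℝ φ x‖ ≤ K) {N : ℝ} (hN : 1 ≤ N) :
    IsCentre (energyF (W N)) (W N) 0 := by
  refine ⟨by rw [Rinf_eq_two hK hN]; exact ENNReal.ofNat_lt_top, ?_⟩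
  rw [Rinf_eq_two hK hN, ENNReal.toReal_ofNat, half_energy_eq hK hN, locEnergy_zero_two]

/-! ## 6. Display (6) fails at the centre `0` for `N` large -/

/-- `y ↦ |DW_N(y)|²_F` is continuous (the Frobenius form is a finite sum of squares of norms of
evaluations, and `DW_N` is continuous). [folklore] -/
theorem continuous_frob_fderiv_W (N : ℝ) :
    Continuous fun y => frobeniusNormSq (fderiv ℝ (W N) y) := by
  have hF : Continuous fun L : E3 →L[ℝ] E3 => frobeniusNormSq L := by
    unfold frobeniusNormSq
    exact continuous_finsetSum _ fun i _ =>
      ((ContinuousLinearMap.apply ℝ E3 (stdOrthonormalBasis ℝ E3 i)).continuous.norm).pow 2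
  exact hF.comp ((contDiff_W N).continuous_fderiv (by simp))

/-- `y ↦ |DW_N(y)|²_F` is continuous and compactly supported, hence bounded. [folklore] -/
theorem exists_bound_frob_W (N : ℝ) :
    ∃ B : ℝ, ∀ y, frobeniusNormSq (fderiv ℝ (W N) y) ≤ B := by
  have hc := continuous_frob_fderiv_W N
  have hs : HasCompactSupport fun y => frobeniusNormSq (fderiv ℝ (W N) y) :=
    ((hasCompactSupport_W N).fderiv (𝕜 := ℝ)).comp_left (g := frobeniusNormSq) frobeniusNormSq_zero
  obtain ⟨B, hB⟩ := hc.bounded_above_of_compact_support hs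
  refine ⟨B, fun y => ?_⟩
  have h := hB y
  rw [Real.norm_eq_abs] at h
  exact (abs_le.mp h).2

/-- The local enstrophy integral over `B(0,4)` is finite … [folklore] -/
theorem lintegral_frob_lt_top (N : ℝ) :
    ∫⁻ y in ball (0 : E3) 4, ENNReal.ofReal (frobeniusNormSq (fderiv ℝ (W N) y)) < ⊤ := by
  obtain ⟨B, hB⟩ := exists_bound_frob_W N
  calc ∫⁻ y in ball (0 : E3) 4, ENNReal.ofReal (frobeniusNormSq (fderiv ℝ (W N) y))
      ≤ ∫⁻ _ in ball (0 : E3) 4, ENNReal.ofReal B :=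
        setLIntegral_mono' measurableSet_ball fun y _ => ENNReal.ofReal_le_ofReal (hB y)
    _ < ⊤ := by
        rw [setLIntegral_const]
        exact ENNReal.mul_lt_top ENNReal.ofReal_lt_top measure_ball_lt_top

/-- … and at least `N² |B(0,1)|`. [folklore] -/
theorem lintegral_frob_ge {N : ℝ} (hN : N ≠ 0) :
    ENNReal.ofReal (N ^ 2) * volume (ball (0 : E3) 1) ≤
      ∫⁻ y in ball (0 : E3) 4, ENNReal.ofReal (frobeniusNormSq (fderiv ℝ (W N) y)) := by
  have hmeas : Measurable fun y => ENNReal.ofReal (frobeniusNormSq (fderiv ℝ (W N) y)) :=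
    (continuous_frob_fderiv_W N).measurable.ennreal_ofReal
  calc ENNReal.ofReal (N ^ 2) * volume (ball (0 : E3) 1)
      = ∫⁻ _ in ball (0 : E3) 1, ENNReal.ofReal (N ^ 2) := (setLIntegral_const _ _).symm
    _ ≤ ∫⁻ y in ball (0 : E3) 1, ENNReal.ofReal (frobeniusNormSq (fderiv ℝ (W N) y)) := by
        refine setLIntegral_mono hmeas fun y hy => ENNReal.ofReal_le_ofReal ?_
        rw [fderiv_W_eq (ball_subset_ball (by norm_num) hy)]
        exact frob_w_ge hN hy
    _ ≤ ∫⁻ y in ball (0 : E3) 4, ENNReal.ofReal (frobeniusNormSq (fderiv ℝ (W N) y)) :=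
        lintegral_mono_set (ball_subset_ball (by norm_num))

/-- **Display (6) is false at the centre `0` of `W_N`** once
`16 |C| (1 + ‖curlCLM‖K)² |B̄₂| < 4 N² |B₁|`. [folklore] -/
theorem not_disp6 {K : ℝ} (hK : ∀ x, ‖fderiv ℝ φ x‖ ≤ K) {N : ℝ} (hN : 1 ≤ N) {C : ℝ}
    (hbig : 16 * |C| * (1 + ‖curlCLM‖ * K) ^ 2 * (volume (closedBall (0 : E3) 2)).toReal <
      4 * N ^ 2 * (volume (ball (0 : E3) 1)).toReal) :
    ¬ Disp6 C (energyF (W N)) (W N) 0 := by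
  have hN0 : N ≠ 0 := by positivity
  intro hD
  unfold Disp6 at hD
  rw [Rinf_eq_two hK hN, ENNReal.toReal_ofNat] at hD
  norm_num at hD
  -- name the quantities
  set I := ∫⁻ y in ball (0 : E3) 4, ENNReal.ofReal (frobeniusNormSq (fderiv ℝ (W N) y)) with hI
  set m := ∫⁻ y, ‖w N y‖ₑ ^ 2 with hm
  set Mb := 1 + ‖curlCLM‖ * K with hMb
  set V1 := (volume (ball (0 : E3) 1)).toReal with hV1
  set V2 := (volume (closedBall (0 : E3) 2)).toReal with hV2
  have hIfin : I ≠ ⊤ := (lintegral_frob_lt_top N).ne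
  have hlocX : locX (W N) (ball 0 4) = I.toReal := rfl
  rw [hlocX, ENNReal.ofReal_toReal hIfin] at hD
  -- lower bound of the left side
  have hV1' : ENNReal.ofReal V1 = volume (ball (0 : E3) 1) := by
    rw [hV1]; exact ENNReal.ofReal_toReal measure_ball_lt_top.ne
  have hlow : ENNReal.ofReal (4 * N ^ 2 * V1) ≤ 4 * I := by
    rw [show 4 * N ^ 2 * V1 = 4 * (N ^ 2 * V1) by ring, ENNReal.ofReal_mul (by norm_num),
      ENNReal.ofReal_mul (by positivity), hV1', ENNReal.ofReal_ofNat]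
    exact mul_le_mul' le_rfl (lintegral_frob_ge hN0)
  -- upper bound of the right side
  have hmfin : m ≠ ⊤ := (lintegral_w_lt_top hK hN).ne
  have hm_le : m.toReal ≤ Mb ^ 2 * V2 := by
    have h := lintegral_w_le hK hN
    have h' := ENNReal.toReal_mono (ENNReal.mul_lt_top ENNReal.ofReal_lt_top measure_closedBall_lt_top).ne h
    rwa [ENNReal.toReal_mul, ENNReal.toReal_ofReal (by positivity)] at h'
  have hE : energyF (W N) = 2 * m.toReal := energyF_W N
  have hup : 8 * C * energyF (W N) ≤ 16 * |C| * Mb ^ 2 * V2 := by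
    rw [hE]
    have h1 : 0 ≤ m.toReal := ENNReal.toReal_nonneg
    have h2 : C * m.toReal ≤ |C| * m.toReal := mul_le_mul_of_nonneg_right (le_abs_self C) h1
    have h3 : |C| * m.toReal ≤ |C| * (Mb ^ 2 * V2) := mul_le_mul_of_nonneg_left hm_le (abs_nonneg C)
    nlinarith
  have hchain : ENNReal.ofReal (4 * N ^ 2 * V1) ≤ ENNReal.ofReal (16 * |C| * Mb ^ 2 * V2) :=
    hlow.trans (hD.trans (ENNReal.ofReal_le_ofReal hup))
  rw [ENNReal.ofReal_le_ofReal_iff (by positivity)] at hchain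
  linarith

/-! ## 7. Main results -/

/-- **Field face of display (6) is false for every `C`.** [cite: Alneel2026, display (6) p.2 l.43–49] -/
theorem not_Step6_field (C : ℝ) : ¬ Step6_field C := by
  intro h6
  obtain ⟨K, hK0, hK⟩ := exists_bound_fderiv_φ
  set Mb := 1 + ‖curlCLM‖ * K with hMb
  set V1 := (volume (ball (0 : E3) 1)).toReal with hV1
  set V2 := (volume (closedBall (0 : E3) 2)).toReal with hV2
  have hV1pos : 0 < V1 :=
    ENNReal.toReal_pos (measure_ball_pos volume (0 : E3) one_pos).ne' measure_ball_lt_top.ne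
  set N : ℝ := 4 * |C| * Mb ^ 2 * V2 / V1 + 1 with hN
  have hq : 0 ≤ 4 * |C| * Mb ^ 2 * V2 / V1 := by positivity
  have hN1 : 1 ≤ N := by rw [hN]; linarith
  have hbig : 16 * |C| * Mb ^ 2 * V2 < 4 * N ^ 2 * V1 := by
    have h1 : 4 * |C| * Mb ^ 2 * V2 / V1 < N := by rw [hN]; linarith
    have h2 : 4 * |C| * Mb ^ 2 * V2 < N * V1 := by rwa [div_lt_iff₀ hV1pos] at h1
    have h3 : 0 ≤ N * (N - 1) * V1 :=
      mul_nonneg (mul_nonneg (by linarith) (sub_nonneg.mpr hN1)) hV1pos.le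
    nlinarith [h2, h3]
  exact not_disp6 hK hN1 hbig (h6 (W N) (isDatum_W N) 0 (isCentre_zero hK hN1))

/-- **Display (6) (`Step6_display C`, binder (6) of `thm21_of_steps`) is false for every `C`** —
its `t = 0` face on admissible data already fails (`step6_field_of`).
[cite: Alneel2026, display (6) p.2 l.43–49] -/
theorem not_Step6_display (C : ℝ) : ¬ Step6_display C :=
  fun h => not_Step6_field C (step6_field_of C h)

/-- Existential packaging: no constant `C` makes display (6) true. [cite: Alneel2026, display (6) p.2 l.43–49] -/
theorem not_exists_Step6_display : ¬ ∃ C : ℝ, Step6_display C :=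
  fun ⟨C, h⟩ => not_Step6_display C h

/-- info: 'Summit.NavierStokesRegularity.NavierStokesRegularity.Theorems.Alneel2026Disp6.not_Step6_field' depends on axioms: [propext,
 Classical.choice,
 Quot.sound] -/
#guard_msgs in #print axioms not_Step6_field

/-- info: 'Summit.NavierStokesRegularity.NavierStokesRegularity.Theorems.Alneel2026Disp6.not_Step6_display' depends on axioms: [propext,
 Classical.choice,
 Quot.sound] -/
#guard_msgs in #print axioms not_Step6_display

end Summit.NavierStokesRegularity.NavierStokesRegularity.Theorems.Alneel2026Disp6
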